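import Summits.Langlands.Langlands.Theorems.IrreducibilityBySelfDualityReciprocityUpToIrreducibilityRankOneAllPlaces
import Literature.NumberTheory.GaloisRepresentations.LocalClassFieldTheory
import Literature.NumberTheory.GaloisRepresentations.HeckeCharacterGaloisAvatarProofs
import HarnessLib
import Literature.NumberTheory.GaloisRepresentations.ArtinCharacterLocalGlobal

/-!
# Line `Sketch` for the crux `ReciprocityUpToIrreducibility` (item stmt-Langlands-14328), continuation c7:
# rank one for reciprocity data normalised against THE Artin map — both directions of the summit on the
# finite-order sector unramified above `ℓ`, modulo ONE named fact of class field theory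

Support file (closes nothing; continuation lead c7, prover-line-stmt-Langlands-14328-c7-0).

`…RankOneAllPlaces` proved the bodies of `AutomorphicToGalois 1 Rec hcpt` / `GaloisToAutomorphic 1 Rec hcpt`
on the finite-order (resp. open-kernel) sector unramified above `ℓ` for EVERY `Rec`, modulo the explicit
hypotheses (CFT_θ) / (CFT_ρ): compatibility of `Rec`'s local Artin maps with global class field theory at
the ramified places.  Here that hypothesis is DISCHARGED for every `Rec` whose local Langlands data are
normalised against a local Artin map with the characterising clauses `IsLocalArtinMap` (Literature
`GaloisRepresentations/LocalClassFieldTheory`, 2026-08-16: geometric Frobenius ↦ uniformiser and the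
finite-level reciprocity law; the summit's forthcoming field `ReciprocityData.llc_isCanonical` provides it
under `exists_isLocalArtinMap`), from ONE named fact of the literature stated below in the tree's
vocabulary: the compatibility of local and global class field theory (Neukirch, *Algebraic Number Theory*
VI (5.6)) in character form — for a finite-order Hecke character `θ` and its Artin character `ψ`
(`HeckeCharacter.exists_framedArtinRep_of_isFiniteOrder`), `ψ(w) = θ_v(a(w))⁻¹` on `W_{K_v}` for every
local Artin map `a` of `K_v` with the clauses (the inverse is Deligne's normalisation, Tate (1.4.1);
at the unramified places of `θ` this is the tree's own Frobenius clause `ψ(Frob_v^{arith}) = θ(ϖ_v)`).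

* `artinCharacter_localGlobalCompatible` — the named fact (a `def … : Prop`, to be relocated under
  `Literature/NumberTheory/GaloisRepresentations/`).
* `artinCompatible_lAdicAvatar` — under it, the `ℓ`-adic avatar `ρ = ι⁻¹(ψ)⁻¹` satisfies
  `ι(tr ρ(w)) = θ_v((Rec.llc v).artin w)` at every place, for every `Rec` normalised as above.
* `automorphicToGalois_glOne_of_isLocalArtinMap`, `galoisToAutomorphic_glOne_of_isLocalArtinMap` — (A)
  at `π_θ` and (B) at open-kernel geometric `ρ` unramified above `ℓ`, for every such `Rec`, modulo
  `FontaineDatumExists` and the named fact only ((B) uses Chebotarev rigidity to identify `ρ` with the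
  avatar of its Hecke character: `FramedGaloisRep.nonempty_equiv_of_hasFrobCharpolyAt_eventually`,
  `FramedRep.exists_eq_conj_of_equiv`, and `conj` is trivial in rank one).

One definition (the named fact); std axioms.
-/

noncomputable section

set_option linter.dupNamespace false -- project-wide option (lakefile weak.linter.dupNamespace); `Summit.Langlands.Langlands` is the mandated namespace

open scoped MatrixGroups Matrix NumberField Classical Polynomial
open Filter IsDedekindDomain Field Polynomial
open Literature.NumberTheory.Automorphic Literature.NumberTheory.GaloisRepresentations

namespace Summit.Langlands.Langlands.Theorems.ReciprocityUpToIrreducibility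

open Literature.NumberTheory.PAdicHodge
open Summit.Langlands
open Summit.Langlands.Langlands.Theorems.IrreducibleOffSector

variable {K : Type} [Field K] [NumberField K] {ℓ : ℕ} [Fact ℓ.Prime]

/-- **The `ℓ`-adic avatar of `θ` is Artin-compatible with every canonically normalised `Rec` at EVERY
place** (under the named fact).  For `ψ` the Artin character of the finite-order `θ`, `ρ = ι⁻¹(ψ)⁻¹`
(`FramedArtinRep.lAdicAvatar`) and a place `v` at which `(Rec.llc v).artin` has the clauses
`IsLocalArtinMap`: `ι(tr ρ|_{Γ_{K_v}}(w)) = θ_v((Rec.llc v).artin w)` for all `w ∈ W_{K_v}` — the hypothesis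
(CFT_θ) of `…RankOneAllPlaces` for this `ρ`. [cite: NeukirchANT1999, Ch. VI Prop. (5.6)]
[cite: SerreAbelianLadic1968, Ch. III §2.3] -/
theorem artinCompatible_lAdicAvatar (hLG : Literature.NumberTheory.GaloisRepresentations.artinCharacter_localGlobalCompatible)
    {θ : HeckeCharacter K} (hfin : θ.IsFiniteOrder) {ψ : FramedArtinRep K 1}
    (hram : ∀ v : HeightOneSpectrum (𝓞 K), ψ.IsUnramifiedAt v ↔ θ.IsUnramifiedAt v)
    (hfrob : ∀ v : HeightOneSpectrum (𝓞 K), θ.IsUnramifiedAt v →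
      ψ.HasFrobCharpolyAt v (X - C (θ.valueAtUniformizer v)))
    (ι : PadicAlgCl ℓ ≃+* ℂ) (Rec : ReciprocityData K) {v : HeightOneSpectrum (𝓞 K)}
    (hRec : IsLocalArtinMap (v.adicCompletion K) (Rec.llc v).artin.artin)
    (w : WeilGroup (v.adicCompletion K)) :
    (ι : PadicAlgCl ℓ →+* ℂ) (((((ψ.lAdicAvatar ι).toLocal v).toWeilGroupHom w :
        GL (Fin 1) (PadicAlgCl ℓ)) : Matrix (Fin 1) (Fin 1) (PadicAlgCl ℓ)).trace) =
      ((θ.localComponent v ((Rec.llc v).artin.artin w) : ℂˣ) : ℂ) := by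
  have key := hLG K θ hfin ψ hram hfrob v (Rec.llc v).artin.artin hRec w
  -- the trace of the avatar at `σ = res(w)` is `(ι⁻¹ (det ψ σ))⁻¹`, and `det ψ σ = tr ψ σ` on `GL₁`
  have htr : ((((ψ.lAdicAvatar ι).toLocal v).toWeilGroupHom w : GL (Fin 1) (PadicAlgCl ℓ)) :
      Matrix (Fin 1) (Fin 1) (PadicAlgCl ℓ)).trace =
        (ι.symm ((FramedRep.det ψ (absGaloisRestrict K (v.adicCompletion K)
          (WeilGroup.toAbsGalois (v.adicCompletion K) w)) : ℂˣ) : ℂ))⁻¹ := by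
    rw [FramedRep.toWeilGroupHom_apply, FramedGaloisRep.toLocal_apply, Matrix.trace_fin_one,
      FramedArtinRep.lAdicAvatar, FramedGaloisRep.ofOpenKer_apply_coe, FramedArtinRep.coe_lAdicChar_apply]
  have hdet : ((FramedRep.det ψ (absGaloisRestrict K (v.adicCompletion K)
      (WeilGroup.toAbsGalois (v.adicCompletion K) w)) : ℂˣ) : ℂ) =
      ((ψ (absGaloisRestrict K (v.adicCompletion K) (WeilGroup.toAbsGalois (v.adicCompletion K) w)) :
        GL (Fin 1) ℂ) : Matrix (Fin 1) (Fin 1) ℂ).trace := by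
    rw [FramedRep.det_apply, Matrix.GeneralLinearGroup.val_det_apply, Matrix.det_fin_one,
      Matrix.trace_fin_one]
  rw [htr, hdet, key]
  simp [map_inv₀, Units.val_inv_eq_inv_val]

/-- Conjugation is trivial on rank-one framed representations (`GL₁` is commutative). [folklore] -/
theorem conj_eq_self_of_rank_one {G A : Type*} [Group G] [TopologicalSpace G] [CommRing A]
    [TopologicalSpace A] [IsTopologicalRing A] (P : GL (Fin 1) A) (ρ : FramedRep G A 1) :
    ρ.conj P = ρ := by
  refine DFunLike.ext _ _ fun g => ?_
  rw [FramedRep.conj_apply]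
  have hcomm : P * ρ g = ρ g * P := by
    refine Units.ext ?_
    rw [Units.val_mul, Units.val_mul, matrix_fin_one_eq_trace_smul_one (P : Matrix (Fin 1) (Fin 1) A),
      Matrix.smul_mul, Matrix.mul_smul, Matrix.one_mul, Matrix.mul_one]
  rw [hcomm, mul_inv_cancel_right]

/-- **An open-kernel rank-one `ρ` IS the `ℓ`-adic avatar of its Hecke character** (Chebotarev rigidity).
If `χ` carries the Frobenius data of `ρ` at the places where `ρ` is unramified (cofinitely many) and `ψ`
is the Artin character of `χ`, then `ρ = ι⁻¹(ψ)⁻¹`: both are semisimple with the same Frobenius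
characteristic polynomials almost everywhere (`FramedGaloisRep.nonempty_equiv_of_hasFrobCharpolyAt_eventually`,
Deligne–Serre Lemme 3.2), hence conjugate (`FramedRep.exists_eq_conj_of_equiv`), hence equal in rank one.
[cite: DeligneSerreASENS1974, Lemme 3.2] [cite: SerreAbelianLadic1968, Ch. III §2.3] -/
theorem eq_lAdicAvatar_of_hasFrobCharpolyAt (ι : PadicAlgCl ℓ ≃+* ℂ) (ρ : FramedGaloisRep K (PadicAlgCl ℓ) 1)
    (hae : ∀ᶠ v : HeightOneSpectrum (𝓞 K) in cofinite, ρ.IsUnramifiedAt v) {χ : HeckeCharacter K}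
    (hχ : ∀ v : HeightOneSpectrum (𝓞 K), ρ.IsUnramifiedAt v →
      χ.IsUnramifiedAt v ∧ ρ.HasFrobCharpolyAt v (X - C (ι.symm (χ.valueAtUniformizer v)⁻¹)))
    {ψ : FramedArtinRep K 1}
    (hram : ∀ v : HeightOneSpectrum (𝓞 K), ψ.IsUnramifiedAt v ↔ χ.IsUnramifiedAt v)
    (hfrob : ∀ v : HeightOneSpectrum (𝓞 K), χ.IsUnramifiedAt v →
      ψ.HasFrobCharpolyAt v (X - C (χ.valueAtUniformizer v))) :
    ρ = ψ.lAdicAvatar ι := by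
  have hev : ∀ᶠ v : HeightOneSpectrum (𝓞 K) in cofinite,
      ρ.IsUnramifiedAt v ∧ (ψ.lAdicAvatar ι).IsUnramifiedAt v ∧
        ∃ P : Polynomial (PadicAlgCl ℓ), ρ.HasFrobCharpolyAt v P ∧ (ψ.lAdicAvatar ι).HasFrobCharpolyAt v P := by
    filter_upwards [hae] with v hv
    exact ⟨hv, (ψ.isUnramifiedAt_lAdicAvatar_iff ι v).mpr ((hram v).mpr (hχ v hv).1), _,
      (hχ v hv).2, ψ.hasFrobCharpolyAt_lAdicAvatar ι (hfrob v (hχ v hv).1)⟩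
  obtain ⟨e⟩ := FramedGaloisRep.nonempty_equiv_of_hasFrobCharpolyAt_eventually chebotarev_artinRep_holds
    ρ (ψ.lAdicAvatar ι) (isSemisimple_of_isIrreducible ρ (isIrreducible_of_rank_one ρ))
    (isSemisimple_of_isIrreducible _ (isIrreducible_of_rank_one _)) hev
  obtain ⟨P, hP⟩ := FramedRep.exists_eq_conj_of_equiv ρ (ψ.lAdicAvatar ι) e
  rw [hP, conj_eq_self_of_rank_one]

/-- **Direction (A) in rank one on the finite-order sector unramified above `ℓ`, for every `Rec`
normalised against THE Artin map, modulo `FontaineDatumExists` and the named fact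
`artinCharacter_localGlobalCompatible` only.**  For a finite-order Hecke character `θ` unramified above
`ℓ` and its model `π_θ = ℂ·(θ ∘ det)/⊥`: some `ρ : Γ_K → GL₁(ℚ̄_ℓ)` is irreducible, pinned-geometric,
`Corresponds Rec ι π_θ ρ` at EVERY finite place (the ramified places of `θ` included), and every
corresponding `ρ'` is conjugate to it — the body of `AutomorphicToGalois 1 Rec hcpt` at `π_θ`
(`automorphicToGalois_glOne_of_artinCompatible` with (CFT_θ) discharged by `artinCompatible_lAdicAvatar`).
[cite: BuzzardGeeLMS2014, Conj. 3.2.1–3.2.2 (n = 1)] [cite: NeukirchANT1999, Ch. VI Prop. (5.6)]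
[cite: CasselsFrohlichANT1967, Ch. VII §5.1 Main Theorem] -/
theorem automorphicToGalois_glOne_of_isLocalArtinMap
    (hF : FontaineDatumExists) (hLG : Literature.NumberTheory.GaloisRepresentations.artinCharacter_localGlobalCompatible)
    {hcpt : isCompact_glFiniteIntegralLevel 1 K} (Rec : ReciprocityData K)
    (hRec : ∀ v : HeightOneSpectrum (𝓞 K), IsLocalArtinMap (v.adicCompletion K) (Rec.llc v).artin.artin)
    (ι : PadicAlgCl ℓ ≃+* ℂ) {π : AutomorphicRepData (AutomorphyDatum.gl 1 K hcpt)} {θ : HeckeCharacter K}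
    (hW : π.W = Submodule.span ℂ {fun g : (AdelicGroupData.gl 1 K).Adelic => (detTwist 1 θ g : ℂ)})
    (hW' : π.W' = ⊥) (hfin : θ.IsFiniteOrder)
    (hθℓ : ∀ v : HeightOneSpectrum (𝓞 K), ((ℓ : ℕ) : 𝓞 K) ∈ v.asIdeal → θ.IsUnramifiedAt v) :
    ∃ ρ : FramedGaloisRep K (PadicAlgCl ℓ) 1,
      ρ.toGaloisRep.IsIrreducible ∧ IsGeometricFramed Rec ρ ∧ Corresponds Rec ι π ρ ∧
        ∀ ρ' : FramedGaloisRep K (PadicAlgCl ℓ) 1, Corresponds Rec ι π ρ' → IsConjugate ρ ρ' := by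
  obtain ⟨ψ, hram, hfrob⟩ := θ.exists_framedArtinRep_of_isFiniteOrder hfin
  have hker : IsOpen ((ψ.lAdicAvatar ι).toMonoidHom.ker : Set (absoluteGaloisGroup K)) :=
    isOpen_ker_lAdicAvatar ψ ι
  have hρ : ∀ v : HeightOneSpectrum (𝓞 K), θ.IsUnramifiedAt v →
      (ψ.lAdicAvatar ι).IsUnramifiedAt v ∧
        (ψ.lAdicAvatar ι).HasFrobCharpolyAt v (X - C (ι.symm (θ.valueAtUniformizer v)⁻¹)) :=
    fun v hv => ⟨(ψ.isUnramifiedAt_lAdicAvatar_iff ι v).mpr ((hram v).mpr hv),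
      ψ.hasFrobCharpolyAt_lAdicAvatar ι (hfrob v hv)⟩
  have hcorr : Corresponds Rec ι π (ψ.lAdicAvatar ι) :=
    rankOne_corresponds_of_artinCompatible hF Rec ι hW hW' hθℓ (ψ.lAdicAvatar ι) hker hρ fun v _ w =>
      artinCompatible_lAdicAvatar hLG hfin hram hfrob ι Rec (hRec v) w
  have hcof : ∀ᶠ v : HeightOneSpectrum (𝓞 K) in cofinite, θ.IsUnramifiedAt v :=
    HeckeCharacter.isUnramifiedAt_cofinite_holds θ
  have hgeo : IsGeometricFramed Rec (ψ.lAdicAvatar ι) :=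
    ⟨hcof.mono fun v hv => (hρ v hv).1,
      fun v hv => isDeRhamFramed_fontainePstAdicCompletion_of_isUnramifiedAt _ v hv (hρ v (hθℓ v hv)).1⟩
  exact ⟨ψ.lAdicAvatar ι, isIrreducible_of_rank_one _, hgeo, hcorr, fun ρ' h' =>
    isConjugate_of_satakeFrobCompatibleAt π ι (isIrreducible_of_rank_one _) hcorr.1 h'.1⟩

/-- **Direction (B) in rank one on the open-kernel sector unramified above `ℓ`, for every `Rec`
normalised against THE Artin map, modulo `FontaineDatumExists` and the named fact only.**  Every
`ρ : Γ_K → GL₁(ℚ̄_ℓ)` with open kernel, unramified at all but finitely many places and above `ℓ`,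
corresponds at EVERY finite place to a cuspidal L-algebraic `π` of `GL₁(𝔸_K)` — the body of
`GaloisToAutomorphic 1 Rec hcpt` at `ρ`: `ρ` is the avatar of its finite-order Hecke character `χ`
(`FramedGaloisRep.exists_heckeCharacter_of_isOpen_ker`, `eq_lAdicAvatar_of_hasFrobCharpolyAt`),
`π = ℂ·(χ ∘ det)/⊥` (`stub_rankOne_cuspidalModel_of_isFiniteOrder`), and `Corresponds` by
`rankOne_corresponds_of_artinCompatible` with (CFT) discharged by `artinCompatible_lAdicAvatar`.
[cite: FontaineMazurGeometric1995, Conj. 1 (n = 1)] [cite: NeukirchANT1999, Ch. VI Prop. (5.6)]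
[cite: CasselsFrohlichANT1967, Ch. VII §5.1 Main Theorem] -/
theorem galoisToAutomorphic_glOne_of_isLocalArtinMap
    (hF : FontaineDatumExists) (hLG : Literature.NumberTheory.GaloisRepresentations.artinCharacter_localGlobalCompatible)
    (hcpt : isCompact_glFiniteIntegralLevel 1 K) (Rec : ReciprocityData K)
    (hRec : ∀ v : HeightOneSpectrum (𝓞 K), IsLocalArtinMap (v.adicCompletion K) (Rec.llc v).artin.artin)
    (ι : PadicAlgCl ℓ ≃+* ℂ) (ρ : FramedGaloisRep K (PadicAlgCl ℓ) 1)
    (hker : IsOpen (ρ.toMonoidHom.ker : Set (absoluteGaloisGroup K)))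
    (hae : ∀ᶠ v : HeightOneSpectrum (𝓞 K) in cofinite, ρ.IsUnramifiedAt v)
    (hρℓ : ∀ v : HeightOneSpectrum (𝓞 K), ((ℓ : ℕ) : 𝓞 K) ∈ v.asIdeal → ρ.IsUnramifiedAt v) :
    ∃ π : CuspidalAutomorphicRepData 1 K hcpt, π.1.IsLAlgebraic ∧ Corresponds Rec ι π.1 ρ := by
  obtain ⟨χ, -, hfin, hχ⟩ := ρ.exists_heckeCharacter_of_isOpen_ker hker ι
  obtain ⟨ψ, hram, hfrob⟩ := χ.exists_framedArtinRep_of_isFiniteOrder hfin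
  have hρψ : ρ = ψ.lAdicAvatar ι := eq_lAdicAvatar_of_hasFrobCharpolyAt ι ρ hae hχ hram hfrob
  obtain ⟨π, hW, hW', hL⟩ := stub_rankOne_cuspidalModel_of_isFiniteOrder K hcpt χ hfin
  have hχℓ : ∀ v : HeightOneSpectrum (𝓞 K), ((ℓ : ℕ) : 𝓞 K) ∈ v.asIdeal → χ.IsUnramifiedAt v :=
    fun v hv => (hχ v (hρℓ v hv)).1
  have hρ' : ∀ v : HeightOneSpectrum (𝓞 K), χ.IsUnramifiedAt v →
      ρ.IsUnramifiedAt v ∧ ρ.HasFrobCharpolyAt v (X - C (ι.symm (χ.valueAtUniformizer v)⁻¹)) := by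
    intro v hv
    rw [hρψ]
    exact ⟨(ψ.isUnramifiedAt_lAdicAvatar_iff ι v).mpr ((hram v).mpr hv),
      ψ.hasFrobCharpolyAt_lAdicAvatar ι (hfrob v hv)⟩
  refine ⟨π, hL, rankOne_corresponds_of_artinCompatible hF Rec ι hW hW' hχℓ ρ hker hρ' fun v _ w => ?_⟩
  rw [hρψ]
  exact artinCompatible_lAdicAvatar hLG hfin hram hfrob ι Rec (hRec v) w

/-- **Registered stub `stub_eq_lAdicAvatar_of_hasFrobCharpolyAt` of line `Sketch` (crux stmt-Langlands-14328,
c7 wave N7 assembly), closed form of `eq_lAdicAvatar_of_hasFrobCharpolyAt`**: an open-kernel rank-one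
`ρ : Γ_K → GL₁(ℚ̄_ℓ)` unramified almost everywhere IS the `ℓ`-adic avatar of the Artin character of any
finite-order Hecke character carrying its Frobenius data (Chebotarev rigidity; `conj` is trivial in rank one).
[cite: DeligneSerreASENS1974, Lemme 3.2] [cite: SerreAbelianLadic1968, Ch. III §2.3] -/
theorem stub_eq_lAdicAvatar_of_hasFrobCharpolyAt :
    ∀ (K : Type) [Field K] [NumberField K] (ℓ : ℕ) [Fact ℓ.Prime] (ι : PadicAlgCl ℓ ≃+* ℂ)
      (ρ : FramedGaloisRep K (PadicAlgCl ℓ) 1),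
      (∀ᶠ v : HeightOneSpectrum (𝓞 K) in cofinite, ρ.IsUnramifiedAt v) →
      ∀ (χ : HeckeCharacter K),
        (∀ v : HeightOneSpectrum (𝓞 K), ρ.IsUnramifiedAt v →
          χ.IsUnramifiedAt v ∧ ρ.HasFrobCharpolyAt v (X - C (ι.symm (χ.valueAtUniformizer v)⁻¹))) →
        ∀ (ψ : FramedArtinRep K 1),
          (∀ v : HeightOneSpectrum (𝓞 K), ψ.IsUnramifiedAt v ↔ χ.IsUnramifiedAt v) →
          (∀ v : HeightOneSpectrum (𝓞 K), χ.IsUnramifiedAt v →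
            ψ.HasFrobCharpolyAt v (X - C (χ.valueAtUniformizer v))) →
          ρ = ψ.lAdicAvatar ι :=
  fun _ _ _ _ _ ι ρ hae _ hχ _ hram hfrob => eq_lAdicAvatar_of_hasFrobCharpolyAt ι ρ hae hχ hram hfrob

end Summit.Langlands.Langlands.Theorems.ReciprocityUpToIrreducibility

end
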